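import Summits.RiemannHypothesis.RiemannHypothesis.Theorems.PfPersistenceMarkovCoreFeynmanHellmann
import Summits.RiemannHypothesis.RiemannHypothesis.Theorems.PfPersistenceArchVirial
import HarnessLib

/-!
# PF persistence (theory 1, edge law): THE MARKOV CORE, XIV — moving the WINDOW by dilation:
# the window kernel, the energy of a dilate, transport of the finite-energy classes

Helper file (`--supports stmt-RiemannHypothesis-19953`); mechanism/rigidity campaign; no RH claims.
Companion text `run/shared/lean/pub/pub-rhpf/pub-rhpf-theory-1/THEORY-EDGE-8.md`.

Files XII–XIII (`PfPersistenceMarkovCoreResponse`, `…FeynmanHellmann`) differentiated the core bottom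
`coreBottom w a` in the WEIGHTS `w` at a fixed window.  Files XIV–XVI differentiate it in the WINDOW
`a` — the parameter that MOVES THE DOMAIN (Hadamard 1908; Garabedian–Schiffer 1952/53; forms with
moving form domain: Kato VII §4, VIII §§3–4) — for the ARCH-ONLY core (table `0`: the killed pure-jump
form with Lévy density `ρ = weilArchDensity` and no atoms), where the answer is complete: the bottom
`archBottom a = coreBottom 0 a` is `C¹` on `(0, ∞)` and obeys the Hadamard–Feynman–Hellmann EDGE LAW
`a · archBottom' a = ∫₀^∞ (tρ)'(s) D_s(Φ_a) ds = −V_arch(Φ_a)` at EVERY window (file XVI,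
`PfPersistenceMarkovCoreWindowFeynmanHellmann`).  Since it holds for the arch-only core of EVERY
windowed form of this type it is structure, not an invariant of ζ; what the prime atoms add are the
kinks of `Theorems/PfPersistenceEdgeLawKink` at the entering windows `a = ½ log n`.

This file is the calculus of the move.  Bombieri's unitary dilation
`weilDilate η f = (1+η)^{1/2} f((1+η)·)` maps the finite-energy class of the window `b` onto that of
the window `b/(1+η)` (`coreAdm_weilDilate`), preserving `‖·‖₂`, and changes the archimedean energy
`𝓔_arch(f) = ∫₀^∞ ρ(t) D_t(f) dt` by an explicit integral against the WINDOW KERNEL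
`archSlope μ s = (G(μs) − G(s))/((μ − 1)s)`, `G(t) = tρ(t)`, `μ = (1+η)⁻¹`:

* `archEnergy_weilDilate`: `𝓔_arch(f_η) = 𝓔_arch(f) + (μ − 1) ∫₀^∞ archSlope μ s · D_s(f) ds`
  (substitution `s = (1+η)t`; `μρ(μs) − ρ(s) = (μ − 1)·archSlope μ s`);
* `abs_archSlope_le`: `|archSlope μ s| ≤ C e^{−min(μ,1)s/4}` (mean value theorem with
  `|(tρ)'| ≤ C e^{−t/4}`, `exists_abs_weilArchVirialDensity_le`), hence
  `|𝓔_arch(f_η) − 𝓔_arch(f)| ≤ 32 C |μ − 1| ‖f‖₂²` for `μ ≥ 1/2` (`abs_archEnergy_weilDilate_sub_le`);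
* `tendsto_archSlope`: `archSlope μ s → (tρ)'(s) = weilArchVirialDensity s` as `μ → 1`;

References: E. Bombieri, Rend. Mat. Acc. Lincei (9) 11 (2000) 183–233, §4 (proof of Thm 5: the
dilation `f_ε`); T. Kato, *Perturbation Theory for Linear Operators* (1966), VII §4, §6.5;
J. Hadamard, Mém. prés. div. sav. Acad. Sci. 33 (1908).
-/

set_option linter.dupNamespace false

noncomputable section

open MeasureTheory Set Filter Metric
open scoped Topology

namespace Summit.RiemannHypothesis.RiemannHypothesis.Theorems.PfPersistence

open Literature.NumberTheory.LFunctions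
open Summit.RiemannHypothesis.RiemannHypothesis.Theorems.WeilWindowFlowWindowLipschitz
  (stub_barrierEnergy_weilIncrement_le_four stub_localizedCut_aesm_weilIncrement)
open Summit.RiemannHypothesis.RiemannHypothesis.Theorems.WeilGroundStateMarkovPart
open Summit.RiemannHypothesis.RiemannHypothesis.Theorems.OddSector (memLp_weilDilate)

variable {a b : ℝ}

/-! ## §1 The archimedean energy and the arch-only bottom -/

/-- The archimedean energy `𝓔_arch(f) = ∫₀^∞ ρ(t) D_t(f) dt` — the energy of the arch-only table at
every window (`tableDirichletEnergy_archOnly`). [cite: Bombieri2000Weil, Thm 2 (p. 193)] -/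
def archEnergy (f : ℝ → ℂ) : ℝ :=
  ∫ t in Ioi (0 : ℝ), weilArchDensity t * weilIncrement f t

/-- **The arch-only window bottom** `ε_arch(a) = coreBottom 0 a`: the bottom of `𝓔_arch` over the
normalised finite-energy class of the window `[-a, a]`. [cite: ReedSimonIV1978, §XIII.12 Thm XIII.44] -/
def archBottom (a : ℝ) : ℝ :=
  coreBottom (fun _ ↦ (0 : ℝ)) a

/-- The arch-only table is non-negative on every index (bookkeeping). [folklore] -/
theorem archOnly_nonneg (a : ℝ) : ∀ n ∈ weilPrimeIndex a, (0 : ℝ) ≤ (fun _ : ℕ ↦ (0 : ℝ)) n :=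
  fun _ _ ↦ le_rfl

/-- The energy of the arch-only table is the archimedean energy, at every window. [folklore] -/
theorem tableDirichletEnergy_archOnly (a : ℝ) (f : ℝ → ℂ) :
    tableDirichletEnergy a (fun _ ↦ (0 : ℝ)) f = archEnergy f := by
  simp [tableDirichletEnergy, archEnergy]

/-! ## §2 The window kernel `archSlope μ s = (G(μs) − G(s))/((μ−1)s)`, `G = tρ` -/

/-- The constant `C > 0` of `exists_abs_weilArchVirialDensity_le`: `|(tρ)'(t)| ≤ C e^{−t/4}`. [folklore] -/
def archVirialConst : ℝ :=
  Classical.choose exists_abs_weilArchVirialDensity_le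

/-- `0 < archVirialConst`. [folklore] -/
theorem archVirialConst_pos : 0 < archVirialConst :=
  (Classical.choose_spec exists_abs_weilArchVirialDensity_le).1

/-- `|(tρ)'(t)| ≤ archVirialConst · e^{−t/4}` for `t > 0`. [folklore] -/
theorem abs_weilArchVirialDensity_le_archVirialConst {t : ℝ} (ht : 0 < t) :
    |weilArchVirialDensity t| ≤ archVirialConst * Real.exp (-(t / 4)) :=
  (Classical.choose_spec exists_abs_weilArchVirialDensity_le).2 t ht

/-- **The window kernel**: the difference quotient of `G(t) = t ρ(t)` between the lengths `s` and
`μ s` (junk `0` at `μ = 1` or `s = 0`). [folklore] -/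
def archSlope (μ s : ℝ) : ℝ :=
  (μ * s * weilArchDensity (μ * s) - s * weilArchDensity s) / ((μ - 1) * s)

/-- The window kernel is the slope of `G = tρ` between `s` and `μ s`. [folklore] -/
theorem archSlope_eq_slope (μ s : ℝ) :
    archSlope μ s = slope (fun t ↦ t * weilArchDensity t) s (μ * s) := by
  rw [slope_def_field, archSlope]
  congr 1
  ring

/-- `μ ρ(μ s) − ρ(s) = (μ − 1) · archSlope μ s` for `s > 0`. [folklore] -/
theorem mul_weilArchDensity_sub {μ s : ℝ} (hs : 0 < s) :
    μ * weilArchDensity (μ * s) - weilArchDensity s = (μ - 1) * archSlope μ s := by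
  rcases eq_or_ne μ 1 with rfl | hμ
  · simp
  · have h1 : (μ - 1) * s ≠ 0 := mul_ne_zero (sub_ne_zero.2 hμ) hs.ne'
    rw [archSlope, mul_div_assoc', eq_div_iff h1]
    ring

/-- The window kernel is measurable in the length. [folklore] -/
theorem measurable_archSlope (μ : ℝ) : Measurable (archSlope μ) := by
  unfold archSlope
  exact (((measurable_const.mul measurable_id).mul
    (measurable_weilArchDensity.comp (measurable_const.mul measurable_id))).sub
      (measurable_id.mul measurable_weilArchDensity)).div (measurable_const.mul measurable_id)

/-- **Mean-value bound for the window kernel**: `|archSlope μ s| ≤ C e^{−min(μ,1) s/4}` for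
`μ, s > 0` (`|(tρ)'| ≤ C e^{−t/4}` on the segment between `s` and `μ s`). [folklore] -/
theorem abs_archSlope_le {μ s : ℝ} (hμ : 0 < μ) (hs : 0 < s) :
    |archSlope μ s| ≤ archVirialConst * Real.exp (-(min μ 1 / 4) * s) := by
  have hK0 : 0 ≤ archVirialConst * Real.exp (-(min μ 1 / 4) * s) :=
    mul_nonneg archVirialConst_pos.le (Real.exp_pos _).le
  rcases eq_or_ne μ 1 with rfl | hμ1
  · simpa [archSlope] using hK0
  set m : ℝ := min μ 1 * s with hm
  have hm0 : 0 < m := mul_pos (lt_min hμ one_pos) hs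
  set K : ℝ := archVirialConst * Real.exp (-(min μ 1 / 4) * s) with hK
  have hderiv : ∀ x ∈ Ici m, HasDerivWithinAt (fun t ↦ t * weilArchDensity t)
      (weilArchVirialDensity x) (Ici m) x := fun x hx ↦
    (hasDerivAt_mul_weilArchDensity (hm0.trans_le hx)).hasDerivWithinAt
  have hbound : ∀ x ∈ Ici m, ‖weilArchVirialDensity x‖ ≤ K := by
    intro x hx
    have hx' : m ≤ x := hx
    rw [Real.norm_eq_abs]
    refine (abs_weilArchVirialDensity_le_archVirialConst (hm0.trans_le hx)).trans ?_
    refine mul_le_mul_of_nonneg_left (Real.exp_le_exp.2 ?_) archVirialConst_pos.le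
    have e : -(min μ 1 / 4) * s = -(m / 4) := by rw [hm]; ring
    rw [e]
    linarith
  have hsm : s ∈ Ici m := by
    show min μ 1 * s ≤ s
    have h := min_le_right μ 1
    nlinarith
  have hμsm : μ * s ∈ Ici m := by
    show min μ 1 * s ≤ μ * s
    exact mul_le_mul_of_nonneg_right (min_le_left μ 1) hs.le
  have hMVT := (convex_Ici m).norm_image_sub_le_of_norm_hasDerivWithin_le hderiv hbound hsm hμsm
  rw [Real.norm_eq_abs, Real.norm_eq_abs, show μ * s - s = (μ - 1) * s by ring] at hMVT
  have hden : 0 < |(μ - 1) * s| := abs_pos.2 (mul_ne_zero (sub_ne_zero.2 hμ1) hs.ne')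
  rw [archSlope, abs_div, div_le_iff₀ hden]
  exact hMVT

/-- … in particular `|archSlope μ s| ≤ C e^{−s/8}` for `μ ≥ 1/2`. [folklore] -/
theorem abs_archSlope_le_of_half_le {μ s : ℝ} (hμ : 1 / 2 ≤ μ) (hs : 0 < s) :
    |archSlope μ s| ≤ archVirialConst * Real.exp (-(1 / 8) * s) := by
  refine (abs_archSlope_le (by linarith) hs).trans
    (mul_le_mul_of_nonneg_left (Real.exp_le_exp.2 ?_) archVirialConst_pos.le)
  have h : 1 / 2 ≤ min μ 1 := le_min hμ (by norm_num)
  nlinarith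

/-- **The window kernel converges to the virial density**: `archSlope μ s → (tρ)'(s)` as `μ → 1`
(`s > 0`). [folklore] -/
theorem tendsto_archSlope {s : ℝ} (hs : 0 < s) :
    Tendsto (fun μ ↦ archSlope μ s) (𝓝[≠] 1) (𝓝 (weilArchVirialDensity s)) := by
  have hG := hasDerivAt_mul_weilArchDensity hs
  rw [hasDerivAt_iff_tendsto_slope] at hG
  have hμ : Tendsto (fun μ : ℝ ↦ μ * s) (𝓝[≠] 1) (𝓝[≠] s) := by
    refine tendsto_nhdsWithin_of_tendsto_nhds_of_eventually_within _ ?_ ?_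
    · have h : Tendsto (fun μ : ℝ ↦ μ * s) (𝓝 1) (𝓝 (1 * s)) :=
        (continuous_id.mul continuous_const).tendsto 1
      rw [one_mul] at h
      exact h.mono_left nhdsWithin_le_nhds
    · filter_upwards [self_mem_nhdsWithin] with μ hμ
      intro h
      exact hμ (mul_right_cancel₀ hs.ne' (by rw [one_mul]; exact h))
  refine (hG.comp hμ).congr fun μ ↦ ?_
  simp only [Function.comp_apply, archSlope_eq_slope]

/-! ## §3 The archimedean energy of a dilate -/

/-- The window kernel integrates against the increments of an `L²` function:
`|archSlope μ s · D_s(f)| ≤ C e^{−min(μ,1)s/4} · 4‖f‖₂²`. [folklore] -/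
theorem integrableOn_archSlope_mul_weilIncrement {f : ℝ → ℂ} (hf : MemLp f 2) {μ : ℝ}
    (hμ : 0 < μ) : IntegrableOn (fun s ↦ archSlope μ s * weilIncrement f s) (Ioi 0) := by
  set N : ℝ := ∫ x, ‖f x‖ ^ 2 with hN
  have hm : 0 < min μ 1 / 4 := by
    have := lt_min hμ one_pos
    positivity
  have hdom : IntegrableOn
      (fun s ↦ archVirialConst * Real.exp (-(min μ 1 / 4) * s) * (4 * N)) (Ioi 0) :=
    ((exp_neg_integrableOn_Ioi 0 hm).const_mul _).mul_const _
  refine hdom.mono' ?_ ?_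
  · exact ((measurable_archSlope μ).aestronglyMeasurable.mul
      (stub_localizedCut_aesm_weilIncrement hf.1)).restrict
  · refine (ae_restrict_iff' measurableSet_Ioi).2 (Eventually.of_forall fun s hs ↦ ?_)
    have hs0 : (0 : ℝ) < s := hs
    rw [Real.norm_eq_abs, abs_mul, abs_of_nonneg (weilIncrement_nonneg f s)]
    exact mul_le_mul (abs_archSlope_le hμ hs0) (stub_barrierEnergy_weilIncrement_le_four hf s)
      (weilIncrement_nonneg f s) (mul_nonneg archVirialConst_pos.le (Real.exp_pos _).le)

/-- Substitution `s = (1+η)t`: `𝓔_arch(f_η) = ∫₀^∞ μ ρ(μ s) D_s(f) ds`, `μ = (1+η)⁻¹` (`η > -1`).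
[cite: Bombieri2000Weil, §4 proof of Thm 5 (the dilation)] -/
theorem archEnergy_weilDilate_eq_integral (f : ℝ → ℂ) {η : ℝ} (hη : -1 < η) :
    archEnergy (weilDilate η f) =
      ∫ s in Ioi (0 : ℝ), (1 + η)⁻¹ * weilArchDensity ((1 + η)⁻¹ * s) * weilIncrement f s := by
  have hc : 0 < 1 + η := by linarith
  unfold archEnergy
  have e : (fun t ↦ weilArchDensity t * weilIncrement (weilDilate η f) t) =
      fun t ↦ (fun u ↦ weilArchDensity ((1 + η)⁻¹ * u) * weilIncrement f u) ((1 + η) * t) := by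
    funext t
    simp only [weilIncrement_weilDilate f hη, ← mul_assoc, inv_mul_cancel₀ hc.ne', one_mul]
  rw [e, integral_comp_mul_left_Ioi (fun u ↦ weilArchDensity ((1 + η)⁻¹ * u) * weilIncrement f u)
    0 hc, mul_zero, smul_eq_mul, ← integral_const_mul]
  refine setIntegral_congr_fun measurableSet_Ioi (fun s _ ↦ ?_)
  ring

/-- **Energy of a dilate.** For `f ∈ L²` of finite archimedean energy and `η > -1`, with
`μ = (1+η)⁻¹`: `𝓔_arch(f_η) = 𝓔_arch(f) + (μ − 1) ∫₀^∞ archSlope μ s · D_s(f) ds`.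
[cite: Bombieri2000Weil, §4 proof of Thm 5 (the dilation)] -/
theorem archEnergy_weilDilate {f : ℝ → ℂ} (hf : MemLp f 2)
    (hE : IntegrableOn (fun t ↦ weilArchDensity t * weilIncrement f t) (Ioi 0)) {η : ℝ}
    (hη : -1 < η) :
    archEnergy (weilDilate η f) = archEnergy f +
      ((1 + η)⁻¹ - 1) * ∫ s in Ioi (0 : ℝ), archSlope (1 + η)⁻¹ s * weilIncrement f s := by
  have hc : 0 < 1 + η := by linarith
  have hμ0 : 0 < (1 + η)⁻¹ := inv_pos.2 hc
  have h2 : ∀ s ∈ Ioi (0 : ℝ), (1 + η)⁻¹ * weilArchDensity ((1 + η)⁻¹ * s) * weilIncrement f s =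
      weilArchDensity s * weilIncrement f s +
        ((1 + η)⁻¹ - 1) * (archSlope (1 + η)⁻¹ s * weilIncrement f s) := by
    intro s hs
    have h := mul_weilArchDensity_sub (μ := (1 + η)⁻¹) (mem_Ioi.1 hs)
    calc (1 + η)⁻¹ * weilArchDensity ((1 + η)⁻¹ * s) * weilIncrement f s
        = (weilArchDensity s + ((1 + η)⁻¹ * weilArchDensity ((1 + η)⁻¹ * s) -
            weilArchDensity s)) * weilIncrement f s := by ring
      _ = _ := by rw [h]; ring
  rw [archEnergy_weilDilate_eq_integral f hη, setIntegral_congr_fun measurableSet_Ioi h2,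
    integral_add hE ((integrableOn_archSlope_mul_weilIncrement hf hμ0).const_mul _),
    integral_const_mul]
  rfl

/-- **`|𝓔_arch(f_η) − 𝓔_arch(f)| ≤ 32 C |μ − 1| ‖f‖₂²`** for `μ = (1+η)⁻¹ ≥ 1/2`
(`|archSlope| ≤ C e^{−s/8}`, `D_s ≤ 4‖f‖₂²`, `∫₀^∞ e^{−s/8} ds = 8`). [folklore] -/
theorem abs_archEnergy_weilDilate_sub_le {f : ℝ → ℂ} (hf : MemLp f 2)
    (hE : IntegrableOn (fun t ↦ weilArchDensity t * weilIncrement f t) (Ioi 0)) {η : ℝ}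
    (hη : -1 < η) (hμ : 1 / 2 ≤ (1 + η)⁻¹) :
    |archEnergy (weilDilate η f) - archEnergy f| ≤
      32 * archVirialConst * |(1 + η)⁻¹ - 1| * ∫ x, ‖f x‖ ^ 2 := by
  set N : ℝ := ∫ x, ‖f x‖ ^ 2 with hN
  have hN0 : 0 ≤ N := integral_nonneg fun _ ↦ by positivity
  have hμ0 : 0 < (1 + η)⁻¹ := by linarith
  have h8 : ∫ s in Ioi (0 : ℝ), Real.exp (-(1 / 8) * s) = 8 := by
    rw [integral_exp_mul_Ioi (by norm_num : (-(1 / 8 : ℝ)) < 0) 0]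
    norm_num
  have hI : |∫ s in Ioi (0 : ℝ), archSlope (1 + η)⁻¹ s * weilIncrement f s| ≤
      32 * archVirialConst * N := by
    calc |∫ s in Ioi (0 : ℝ), archSlope (1 + η)⁻¹ s * weilIncrement f s|
        ≤ ∫ s in Ioi (0 : ℝ), |archSlope (1 + η)⁻¹ s * weilIncrement f s| :=
          abs_integral_le_integral_abs
      _ ≤ ∫ s in Ioi (0 : ℝ), archVirialConst * Real.exp (-(1 / 8) * s) * (4 * N) := by
          refine setIntegral_mono_on (integrableOn_archSlope_mul_weilIncrement hf hμ0).abs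
            (((exp_neg_integrableOn_Ioi 0 (by norm_num : (0 : ℝ) < 1 / 8)).const_mul _).mul_const
              _) measurableSet_Ioi (fun s hs ↦ ?_)
          rw [abs_mul, abs_of_nonneg (weilIncrement_nonneg f s)]
          exact mul_le_mul (abs_archSlope_le_of_half_le hμ hs)
            (stub_barrierEnergy_weilIncrement_le_four hf s) (weilIncrement_nonneg f s)
            (mul_nonneg archVirialConst_pos.le (Real.exp_pos _).le)
      _ = 32 * archVirialConst * N := by
          rw [integral_mul_const, integral_const_mul, h8]
          ring
  rw [archEnergy_weilDilate hf hE hη, add_sub_cancel_left, abs_mul]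
  calc |(1 + η)⁻¹ - 1| * |∫ s in Ioi (0 : ℝ), archSlope (1 + η)⁻¹ s * weilIncrement f s|
      ≤ |(1 + η)⁻¹ - 1| * (32 * archVirialConst * N) :=
        mul_le_mul_of_nonneg_left hI (abs_nonneg _)
    _ = 32 * archVirialConst * |(1 + η)⁻¹ - 1| * N := by ring

/-- **Dilates of finite-energy functions have finite archimedean energy** (every `η > -1`; no
support hypothesis — compare `integrableOn_arch_weilDilate`). [folklore] -/
theorem integrableOn_arch_weilDilate_of_memLp {f : ℝ → ℂ} (hf : MemLp f 2)
    (hE : IntegrableOn (fun t ↦ weilArchDensity t * weilIncrement f t) (Ioi 0)) {η : ℝ}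
    (hη : -1 < η) :
    IntegrableOn (fun t ↦ weilArchDensity t * weilIncrement (weilDilate η f) t) (Ioi 0) := by
  have hc : 0 < 1 + η := by linarith
  set μ : ℝ := (1 + η)⁻¹ with hμ
  have hμ0 : 0 < μ := inv_pos.2 hc
  have hG : IntegrableOn (fun s ↦ μ * weilArchDensity (μ * s) * weilIncrement f s) (Ioi 0) := by
    have h := hE.add ((integrableOn_archSlope_mul_weilIncrement hf hμ0).const_mul (μ - 1))
    refine h.congr_fun (fun s hs ↦ ?_) measurableSet_Ioi
    have h' := mul_weilArchDensity_sub (μ := μ) (mem_Ioi.1 hs)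
    show weilArchDensity s * weilIncrement f s + (μ - 1) * (archSlope μ s * weilIncrement f s) =
      μ * weilArchDensity (μ * s) * weilIncrement f s
    calc weilArchDensity s * weilIncrement f s + (μ - 1) * (archSlope μ s * weilIncrement f s)
        = (weilArchDensity s + (μ - 1) * archSlope μ s) * weilIncrement f s := by ring
      _ = μ * weilArchDensity (μ * s) * weilIncrement f s := by rw [← h']; ring
  have h1 : ∀ t : ℝ, μ * ((1 + η) * t) = t := fun t ↦ by
    rw [hμ, ← mul_assoc, inv_mul_cancel₀ hc.ne', one_mul]
  have h2 : (1 + η) * μ = 1 := by rw [hμ, mul_inv_cancel₀ hc.ne']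
  have e : (fun t ↦ weilArchDensity t * weilIncrement (weilDilate η f) t) =
      fun t ↦ (fun u ↦ (1 + η) * (μ * weilArchDensity (μ * u) * weilIncrement f u))
        ((1 + η) * t) := by
    funext t
    simp only [weilIncrement_weilDilate f hη, h1]
    calc weilArchDensity t * weilIncrement f ((1 + η) * t)
        = ((1 + η) * μ) * (weilArchDensity t * weilIncrement f ((1 + η) * t)) := by
          rw [h2, one_mul]
      _ = _ := by ring
  rw [e, integrableOn_Ioi_comp_mul_left_iff
    (fun u ↦ (1 + η) * (μ * weilArchDensity (μ * u) * weilIncrement f u)) 0 hc, mul_zero]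
  exact hG.const_mul _

/-! ## §4 Dilation transports the finite-energy classes between windows -/

/-- **`f ∈ coreAdm b ⇒ weilDilate η f ∈ coreAdm (b/(1+η))`** (`η > -1`): square integrable
(`memLp_weilDilate`), vanishing off the compressed window, finite archimedean energy
(`integrableOn_arch_weilDilate_of_memLp`). [cite: Bombieri2000Weil, §4 proof of Thm 5 (the dilation)] -/
theorem coreAdm_weilDilate {f : ℝ → ℂ} (hf : coreAdm b f) {η : ℝ} (hη : -1 < η) :
    coreAdm (b / (1 + η)) (weilDilate η f) := by
  have hc : 0 < 1 + η := by linarith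
  refine ⟨memLp_weilDilate hf.1 hη, fun x hx ↦ ?_,
    integrableOn_arch_weilDilate_of_memLp hf.1 hf.2.2 hη⟩
  rw [weilDilate_apply, hf.2.1 _ (fun hmem ↦ hx ?_), mul_zero]
  rw [mem_Icc] at hmem ⊢
  constructor
  · rw [show -(b / (1 + η)) = -b / (1 + η) by ring, div_le_iff₀ hc]
    linarith [hmem.1]
  · rw [le_div_iff₀ hc]
    linarith [hmem.2]

/-- Dilation is linear: `(f − g)_η = f_η − g_η` pointwise. [folklore] -/
theorem weilDilate_sub (η : ℝ) (f g : ℝ → ℂ) (x : ℝ) :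
    weilDilate η (fun t ↦ f t - g t) x = weilDilate η f x - weilDilate η g x := by
  simp only [weilDilate_apply, mul_sub]

/-- Dilation commutes with scalars: `(c f)_η = c f_η` pointwise. [folklore] -/
theorem weilDilate_const_mul (η : ℝ) (c : ℂ) (f : ℝ → ℂ) (x : ℝ) :
    weilDilate η (fun t ↦ c * f t) x = c * weilDilate η f x := by
  simp only [weilDilate_apply]
  ring

/-- The window shift `b ↦ a`: the parameter `η = b/a − 1` has `1 + η = b/a`, `(1+η)⁻¹ = a/b`,
`b/(1+η) = a` (`a, b > 0`). [folklore] -/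
theorem windowShift_param (ha : 0 < a) (hb : 0 < b) :
    -1 < b / a - 1 ∧ (1 + (b / a - 1))⁻¹ = a / b ∧ b / (1 + (b / a - 1)) = a := by
  refine ⟨by have := div_pos hb ha; linarith, ?_, ?_⟩
  · rw [show 1 + (b / a - 1) = b / a by ring, inv_div]
  · rw [show 1 + (b / a - 1) = b / a by ring]
    field_simp

/-- **Moving a window-`b` state to the window `a`**: `f ∈ coreAdm b ⇒ weilDilate (b/a − 1) f ∈
coreAdm a`. [cite: Bombieri2000Weil, §4 proof of Thm 5 (the dilation)] -/
theorem coreAdm_windowShift {f : ℝ → ℂ} (hf : coreAdm b f) (ha : 0 < a) (hb : 0 < b) :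
    coreAdm a (weilDilate (b / a - 1) f) := by
  obtain ⟨h1, -, h3⟩ := windowShift_param ha hb
  have h := coreAdm_weilDilate hf h1
  rwa [h3] at h

/-- A window-`b` test function moved to the window `a` is a window-`a` test function.
[cite: Bombieri2000Weil, §4 proof of Thm 5 (the dilation)] -/
theorem isWeilTest_windowShift {g : ℝ → ℂ} (hg : IsWeilTest g) (hgs : tsupport g ⊆ Icc (-b) b)
    (ha : 0 < a) (hb : 0 < b) :
    IsWeilTest (weilDilate (b / a - 1) g) ∧ tsupport (weilDilate (b / a - 1) g) ⊆ Icc (-a) a := by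
  obtain ⟨h1, -, h3⟩ := windowShift_param ha hb
  refine ⟨hg.weilDilate h1, ?_⟩
  have h := tsupport_weilDilate_subset g h1 hgs
  rwa [h3] at h

/-- **The energy cost of moving a state to a nearby window**: for `b ≤ 2a`,
`𝓔_arch(weilDilate (b/a − 1) f) ≤ 𝓔_arch(f) + 32 C |a/b − 1| ‖f‖₂²`. [folklore] -/
theorem archEnergy_windowShift_le {f : ℝ → ℂ} (hf : MemLp f 2)
    (hE : IntegrableOn (fun t ↦ weilArchDensity t * weilIncrement f t) (Ioi 0)) (ha : 0 < a)
    (hb : 0 < b) (hab : b ≤ 2 * a) :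
    archEnergy (weilDilate (b / a - 1) f) ≤
      archEnergy f + 32 * archVirialConst * |a / b - 1| * ∫ x, ‖f x‖ ^ 2 := by
  obtain ⟨h1, h2, -⟩ := windowShift_param ha hb
  have hμ : 1 / 2 ≤ (1 + (b / a - 1))⁻¹ := by
    rw [h2, le_div_iff₀ hb]
    linarith
  have h := abs_archEnergy_weilDilate_sub_le hf hE h1 hμ
  rw [h2] at h
  linarith [(abs_sub_le_iff.1 h).1]

end Summit.RiemannHypothesis.RiemannHypothesis.Theorems.PfPersistence

end
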